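import Literature.AnabelianGeometry.AbsoluteAnabelian.MLFReciprocityInputs
import Literature.AnabelianGeometry.AbsoluteAnabelian.LocalResidueFixedFieldProofs
import Literature.AnabelianGeometry.AbsoluteAnabelian.MLFInertiaBridgeProofs
import Literature.AnabelianGeometry.AbsoluteAnabelian.MLFResidueCardBridgeProofs
import Literature.NumberTheory.GaloisRepresentations.LocalReciprocityThetaProofs
import Literature.NumberTheory.GaloisRepresentations.LocalFieldFiniteExtension
import Literature.NumberTheory.GaloisRepresentations.LocalFieldPadicProofs
import Literature.NumberTheory.GaloisRepresentations.AbsGaloisGroupCompact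
import Mathlib.FieldTheory.Finite.GaloisField
import Mathlib.FieldTheory.Galois.Infinite
import HarnessLib

/-!
# Discharge of `mlf_unramified_criterion` ([AbsAnab] Prop 1.2.1 (ii): "whether or not a finite
# extension is unramified may be determined group-theoretically") from the tree's local theory

The named fact `mlf_unramified_criterion` (`MLFReciprocityInputs.lean`): for an MLF `K/ℚ_p` and a
finite subextension `E ⊆ K̄`, `I_K ≤ Gal(K̄/E)` iff `q_E = q_K^{[E:K]}`, with the ELEMENTARY
`q = residueCardMLF = #μ_{(p')} + 1` and `I_K = inertiaSubgroupMLF` of `MLFGaloisGroups.lean`.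

PROVED here (`mlf_unramified_criterion_holds`).  In the valued model (`IsNonarchimedeanLocalField K`,
residue characteristic `p`, `q = |k_K|`), for an open subgroup `N ≤ Γ_K`:

* `natCard_fixedRoots_add_one`: the roots of unity of `K̄` of order prime to `p`
  fixed by `N` number `q^{[Γ_K : N·I_K]} - 1` — Teichmüller (`μ_{(p')}(K̄) ≅ k̄^×` equivariantly:
  `mem_or_exists_rootOfUnity_sub_mem`, `eq_of_pow_eq_one_of_sub_mem_absMaximalIdeal`) and the
  identification of the residues fixed by `N·I_K` with `𝔽_{q^m}`, `m = [Γ_K : N·I_K]`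
  (`LocalResidueFixedFieldProofs.lean`); i.e. `f(E/K) = [Γ_K : Gal(K̄/E)·I_K]`;
* `absInertia_le_iff_natCard`: hence `I_K ≤ N ↔ #μ_{(p')}(K̄)^N + 1 = q^{[Γ_K : N]}`
  (`N·I_K = N` iff the indices agree);
* the bridge to the `ℚ_p`-binder statement: `FiniteExtension.isNonarchimedeanLocalField ℚ_[p] K`,
  `inertiaSubgroupMLF_eq_absInertia`, `residueCardMLF_eq_residueFieldCard`, and
  `μ_{(p')}(E) = μ_{(p')}(K̄)^{Gal(K̄/E)}` (fundamental theorem of infinite Galois theory).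

Serre, *Local Fields*, Ch. III §5 (unramified extensions ↔ residue extensions), Ch. IV §4 Cor. 2
to Prop. 16; Neukirch, *ANT* II (7.12).  Proof-only: no definitions.  With this, [AbsAnab]
Prop 1.2.1 (ii) (`MLFInertiaProofs.lean`) rests only on the rank formula `thm26_ii_delta_gal`.
-/

noncomputable section

open scoped Pointwise Valued
open ValuativeRel Field Polynomial

namespace Literature.AnabelianGeometry.AbsoluteAnabelian

open Literature.NumberTheory.GaloisRepresentations
open Literature.NumberTheory.GaloisRepresentations.IsNonarchimedeanLocalField

section Valued

variable {K : Type} [Field K] [ValuativeRel K] [TopologicalSpace K] [IsNonarchimedeanLocalField K]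

-- the tower of quotient fields `𝒪[K] ⧸ 𝔓 ∩ 𝒪[K] → S ⧸ 𝔓` makes instance synthesis slow
set_option maxHeartbeats 800000 in
set_option synthInstance.maxHeartbeats 100000 in
/-- **`#μ_{(p')}(K̄)^N + 1 = q^{[Γ_K : N·I_K]}`** for an open subgroup `N ≤ Γ_K` (`f(E/K) =
[Γ_K : Gal(K̄/E) I_K]` for `E` the fixed field of `N`): the Teichmüller bijection `μ_{(p')}(K̄) ≅ k̄^×`
is `Γ_K`-equivariant and the residues fixed by `N·I_K` form `𝔽_{q^m}`, `m = [Γ_K : N·I_K]`.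
Serre, *Local Fields*, Ch. III §5 Thm. 3, Ch. IV §4 Prop. 16. [cite: SerreLocalFields1979, Ch. III §5 Thm. 3] -/
theorem natCard_fixedRoots_add_one {p : ℕ} [Fact p.Prime] (hp : ringChar 𝓀[K] = p)
    (N : Subgroup (absoluteGaloisGroup K)) (hN : IsOpen (N : Set (absoluteGaloisGroup K))) :
    Nat.card {ζ : AlgebraicClosure K | ζ ∈ primeToRootsOfUnity p (AlgebraicClosure K) ∧ ∀ τ ∈ N, τ • ζ = ζ} + 1 = residueFieldCard K ^ (N ⊔ absInertia K).index := by
  classical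
  -- residue fields
  haveI h𝔓 : (absMaximalIdeal K).IsMaximal := absMaximalIdeal_isMaximal_holds K
  letI := Ideal.Quotient.field (absMaximalIdeal K)
  haveI : ((absMaximalIdeal K).under 𝒪[K]).IsMaximal := Ideal.IsMaximal.under 𝒪[K] _
  letI := Ideal.Quotient.field ((absMaximalIdeal K).under 𝒪[K])
  haveI : Finite (𝒪[K] ⧸ (absMaximalIdeal K).under 𝒪[K]) := Nat.finite_of_card_ne_zero (by
    rw [card_quotient_under_absMaximalIdeal_holds K]
    exact residueFieldCard_ne_zero K)
  letI : Fintype (𝒪[K] ⧸ (absMaximalIdeal K).under 𝒪[K]) := Fintype.ofFinite _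
  have hq2 : 2 ≤ residueFieldCard K := one_lt_residueFieldCard K
  haveI : IsAlgClosed (absIntegers 𝒪[K] K ⧸ absMaximalIdeal K) :=
    isAlgClosed_quotient_absMaximalIdeal K
  have hqR : ((residueFieldCard K : ℕ) : absIntegers 𝒪[K] K ⧸ absMaximalIdeal K) = 0 := by
    have hq : Fintype.card (𝒪[K] ⧸ (absMaximalIdeal K).under 𝒪[K]) = residueFieldCard K := by
      rw [Fintype.card_eq_nat_card, card_quotient_under_absMaximalIdeal_holds K]
    rw [← hq, ← map_natCast (algebraMap (𝒪[K] ⧸ (absMaximalIdeal K).under 𝒪[K])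
      (absIntegers 𝒪[K] K ⧸ absMaximalIdeal K)), FiniteField.cast_card_eq_zero, map_zero]
  -- the open subgroup `H = N ⊔ I_K ⊇ I_K`, of finite index `m`
  set H : Subgroup (absoluteGaloisGroup K) := N ⊔ absInertia K with hHdef
  have hI : absInertia K ≤ H := le_sup_right
  have hNH : N ≤ H := le_sup_left
  have hH : IsOpen (H : Set (absoluteGaloisGroup K)) := Subgroup.isOpen_mono hNH hN
  haveI : CompactSpace (absoluteGaloisGroup K) := absoluteGaloisGroup_compactSpace K
  haveI : Finite (absoluteGaloisGroup K ⧸ N) := Subgroup.quotient_finite_of_isOpen N hN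
  haveI : N.FiniteIndex := Subgroup.finiteIndex_of_finite_quotient
  haveI : H.FiniteIndex := Subgroup.finiteIndex_of_le hNH
  set m := H.index with hm
  have hm0 : 0 < m := Nat.pos_of_ne_zero Subgroup.FiniteIndex.index_ne_zero
  have hqm : 1 < residueFieldCard K ^ m := Nat.one_lt_pow hm0.ne' hq2
  -- the set `Y = {y ∈ k̄ | y^(q^m) = y}` has `q^m` elements
  set P : (absIntegers 𝒪[K] K ⧸ absMaximalIdeal K)[X] := X ^ (residueFieldCard K ^ m) - X with hP
  have hPne : P ≠ 0 := FiniteField.X_pow_card_pow_sub_X_ne_zero _ hm0.ne' hq2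
  have hcardY : Fintype.card (P.rootSet (absIntegers 𝒪[K] K ⧸ absMaximalIdeal K)) =
      residueFieldCard K ^ m := by
    haveI : CharP (absIntegers 𝒪[K] K ⧸ absMaximalIdeal K)
        (ringChar (absIntegers 𝒪[K] K ⧸ absMaximalIdeal K)) := ringChar.charP _
    have hsep : P.Separable := by
      rw [hP]
      refine galois_poly_separable (ringChar (absIntegers 𝒪[K] K ⧸ absMaximalIdeal K)) _ ?_
      exact (ringChar.spec _ _).mp (by rw [Nat.cast_pow, hqR, zero_pow hm0.ne'])
    rw [Polynomial.card_rootSet_eq_natDegree hsep (IsAlgClosed.splits _), hP,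
      FiniteField.X_pow_card_pow_sub_X_natDegree_eq _ hm0.ne' hq2]
  have hmemY : ∀ y : absIntegers 𝒪[K] K ⧸ absMaximalIdeal K,
      y ∈ P.rootSet (absIntegers 𝒪[K] K ⧸ absMaximalIdeal K) ↔
        y ^ (residueFieldCard K ^ m) = y := by
    intro y
    have haeval : aeval y P = y ^ (residueFieldCard K ^ m) - y := by simp [hP]
    rw [Polynomial.mem_rootSet, haeval, sub_eq_zero]
    exact ⟨fun h => h.2, fun h => ⟨hPne, h⟩⟩
  -- integrality of roots of unity
  have hint : ∀ ζ : AlgebraicClosure K, ζ ∈ primeToRootsOfUnity p (AlgebraicClosure K) →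
      IsIntegral 𝒪[K] ζ := by
    rintro ζ ⟨n, hn, -, hζ⟩
    exact IsIntegral.of_pow hn (by rw [hζ]; exact isIntegral_one)
  -- the map `ζ ↦ ζ mod 𝔓` from the `N`-fixed roots of unity to `Y ∖ {0}`
  have hne0 : ∀ (ζ : AlgebraicClosure K) (hζ : ζ ∈ primeToRootsOfUnity p (AlgebraicClosure K)),
      Ideal.Quotient.mk (absMaximalIdeal K) ⟨ζ, hint ζ hζ⟩ ≠ 0 := by
    rintro ζ ⟨n, hn, hpn, hζn⟩ h0
    rw [Ideal.Quotient.eq_zero_iff_mem] at h0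
    have h1 : (⟨ζ, hint ζ ⟨n, hn, hpn, hζn⟩⟩ : absIntegers 𝒪[K] K) ^ n = 1 := Subtype.ext hζn
    have : (1 : absIntegers 𝒪[K] K) ∈ absMaximalIdeal K := by
      rw [← h1]; exact Ideal.pow_mem_of_mem _ h0 n hn
    exact h𝔓.ne_top ((Ideal.eq_top_iff_one _).mpr this)
  -- `H` fixes the residue of every `N`-fixed root of unity
  have hHfix : ∀ (ζ : AlgebraicClosure K) (hζ : ζ ∈ {ζ : AlgebraicClosure K | ζ ∈ primeToRootsOfUnity p (AlgebraicClosure K) ∧ ∀ τ ∈ N, τ • ζ = ζ}),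
      ∀ τ ∈ H, τ • (⟨ζ, hint ζ hζ.1⟩ : absIntegers 𝒪[K] K) - ⟨ζ, hint ζ hζ.1⟩ ∈
        absMaximalIdeal K := by
    intro ζ hζ τ hτ
    set z : absIntegers 𝒪[K] K := ⟨ζ, hint ζ hζ.1⟩ with hz
    -- the stabiliser of `z mod 𝔓` is a subgroup containing `N` and `I_K`
    let St : Subgroup (absoluteGaloisGroup K) :=
      { carrier := {σ | σ • z - z ∈ absMaximalIdeal K}
        mul_mem' := by
          intro a b ha hb
          have ha' : a • (b • z - z) ∈ absMaximalIdeal K := by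
            have h : a • (b • z - z) ∈ a • absMaximalIdeal K :=
              Ideal.smul_mem_pointwise_smul _ _ _ hb
            rwa [smul_absMaximalIdeal_holds K a] at h
          have : (a * b) • z - z = a • (b • z - z) + (a • z - z) := by
            rw [mul_smul, smul_sub]; abel
          change (a * b) • z - z ∈ absMaximalIdeal K
          rw [this]
          exact Ideal.add_mem _ ha' ha
        one_mem' := by simp
        inv_mem' := by
          intro a ha
          have h : a⁻¹ • (a • z - z) ∈ a⁻¹ • absMaximalIdeal K :=
            Ideal.smul_mem_pointwise_smul _ _ _ ha
          rw [smul_absMaximalIdeal_holds K a⁻¹, smul_sub, inv_smul_smul] at h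
          change a⁻¹ • z - z ∈ absMaximalIdeal K
          rw [← Ideal.neg_mem_iff, neg_sub]
          exact h }
    have hle : H ≤ St := by
      rw [hHdef]
      refine sup_le (fun σ hσ => ?_) (fun σ hσ => mem_absInertia_iff.mp hσ _)
      change σ • z - z ∈ absMaximalIdeal K
      have : σ • z = z := Subtype.ext (hζ.2 σ hσ)
      rw [this, sub_self]; exact Ideal.zero_mem _
    exact hle hτ
  let Ψ : {ζ : AlgebraicClosure K | ζ ∈ primeToRootsOfUnity p (AlgebraicClosure K) ∧ ∀ τ ∈ N, τ • ζ = ζ} → {y : P.rootSet (absIntegers 𝒪[K] K ⧸ absMaximalIdeal K) // y.1 ≠ 0} :=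
    fun ζ => ⟨⟨Ideal.Quotient.mk (absMaximalIdeal K) ⟨ζ.1, hint ζ.1 ζ.2.1⟩, by
      rw [hmemY, ← map_pow, Ideal.Quotient.eq]
      exact pow_sub_mem_of_forall_mem_smul_sub_mem hI _ (hHfix ζ.1 ζ.2)⟩, hne0 ζ.1 ζ.2.1⟩
  have hΨ : Function.Bijective Ψ := by
    constructor
    · -- injective: roots of unity of order prime to `p` are distinct mod `𝔓`
      rintro ⟨ζ₁, ⟨n₁, hn₁, hpn₁, hζ₁⟩, hf₁⟩ ⟨ζ₂, ⟨n₂, hn₂, hpn₂, hζ₂⟩, hf₂⟩ h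
      have h' := congrArg (fun y => ((y.1 : P.rootSet _) : absIntegers 𝒪[K] K ⧸ absMaximalIdeal K)) h
      simp only [Ψ] at h'
      rw [Ideal.Quotient.eq] at h'
      have hp' : ¬ ringChar 𝓀[K] ∣ n₁ * n₂ := by
        rw [hp]; exact fun hd => ((Fact.out : p.Prime).dvd_mul.mp hd).elim hpn₁ hpn₂
      have e := eq_of_pow_eq_one_of_sub_mem_absMaximalIdeal (F := K) hp' (Nat.mul_ne_zero hn₁.ne' hn₂.ne')
        (ζ₁ := ⟨ζ₁, hint ζ₁ ⟨n₁, hn₁, hpn₁, hζ₁⟩⟩) (ζ₂ := ⟨ζ₂, hint ζ₂ ⟨n₂, hn₂, hpn₂, hζ₂⟩⟩)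
        (Subtype.ext (by simp [pow_mul, hζ₁])) (Subtype.ext (by
          simp [mul_comm n₁ n₂, pow_mul, hζ₂])) h'
      apply Subtype.ext
      change ζ₁ = ζ₂
      exact congrArg (fun z : absIntegers 𝒪[K] K => (z : AlgebraicClosure K)) e
    · -- surjective: a non-zero residue fixed by `H` lifts to a root of unity fixed by `N`
      rintro ⟨⟨y, hy⟩, hy0⟩
      obtain ⟨b, rfl⟩ := Ideal.Quotient.mk_surjective y
      have hb : b ∉ absMaximalIdeal K := fun h => hy0 (Ideal.Quotient.eq_zero_iff_mem.mpr h)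
      rcases mem_or_exists_rootOfUnity_sub_mem (F := K) b with hb' | ⟨n, ζS, hpn, hn0, hζn, hbζ⟩
      · exact absurd hb' hb
      rw [hp] at hpn
      have hyζ : Ideal.Quotient.mk (absMaximalIdeal K) b = Ideal.Quotient.mk _ ζS :=
        (Ideal.Quotient.eq).mpr hbζ
      have hζroot : (ζS : AlgebraicClosure K) ∈ primeToRootsOfUnity p (AlgebraicClosure K) :=
        ⟨n, Nat.pos_of_ne_zero hn0, hpn, by rw [← SubmonoidClass.coe_pow, hζn, OneMemClass.coe_one]⟩
      -- `N` fixes `ζS`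
      have hfix : ∀ τ ∈ N, τ • (ζS : AlgebraicClosure K) = ζS := by
        intro τ hτ
        have hyq : ζS ^ (residueFieldCard K ^ m) - ζS ∈ absMaximalIdeal K := by
          rw [← Ideal.Quotient.eq, map_pow, ← hyζ]
          exact (hmemY _).mp hy
        have h1 : τ • ζS - ζS ∈ absMaximalIdeal K :=
          smul_sub_mem_of_pow_sub_mem hI hH ζS hyq (hNH hτ)
        have h2 : (τ • ζS) ^ n = 1 := by rw [← smul_pow', hζn, smul_one]
        have e := eq_of_pow_eq_one_of_sub_mem_absMaximalIdeal (F := K) (hp.symm ▸ hpn) hn0 h2 hζn h1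
        exact congrArg Subtype.val e
      refine ⟨⟨(ζS : AlgebraicClosure K), hζroot, hfix⟩, ?_⟩
      apply Subtype.ext; apply Subtype.ext
      simp only [Ψ]
      rw [hyζ]
  -- counting
  haveI : Fintype {y : P.rootSet (absIntegers 𝒪[K] K ⧸ absMaximalIdeal K) // y.1 ≠ 0} :=
    Fintype.ofFinite _
  have hcard1 : Nat.card {ζ : AlgebraicClosure K | ζ ∈ primeToRootsOfUnity p (AlgebraicClosure K) ∧ ∀ τ ∈ N, τ • ζ = ζ} =
      Fintype.card {y : P.rootSet (absIntegers 𝒪[K] K ⧸ absMaximalIdeal K) // y.1 ≠ 0} := by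
    rw [Nat.card_congr (Equiv.ofBijective Ψ hΨ), Nat.card_eq_fintype_card]
  -- `#{y ∈ Y | y ≠ 0} + 1 = #Y` (as `0 ∈ Y`)
  have h0Y : (0 : absIntegers 𝒪[K] K ⧸ absMaximalIdeal K) ∈
      P.rootSet (absIntegers 𝒪[K] K ⧸ absMaximalIdeal K) := by
    rw [hmemY]; exact zero_pow (by positivity)
  have hcard2 : Fintype.card {y : P.rootSet (absIntegers 𝒪[K] K ⧸ absMaximalIdeal K) //
      y.1 ≠ 0} + 1 = Fintype.card (P.rootSet (absIntegers 𝒪[K] K ⧸ absMaximalIdeal K)) := by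
    have := Fintype.card_subtype_compl (fun y : P.rootSet (absIntegers 𝒪[K] K ⧸ absMaximalIdeal K) =>
      y.1 = 0)
    have h1 : Fintype.card {y : P.rootSet (absIntegers 𝒪[K] K ⧸ absMaximalIdeal K) //
        y.1 = 0} = 1 := by
      rw [Fintype.card_eq_one_iff]
      exact ⟨⟨⟨0, h0Y⟩, rfl⟩, fun ⟨⟨y, hy⟩, hy0⟩ => Subtype.ext (Subtype.ext hy0)⟩
    have hpos : 0 < Fintype.card (P.rootSet (absIntegers 𝒪[K] K ⧸ absMaximalIdeal K)) :=
      Fintype.card_pos_iff.mpr ⟨⟨0, h0Y⟩⟩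
    simp only [ne_eq] at this ⊢
    omega
  rw [hcard1, hcard2, hcardY]

/-- **`I_K ≤ N ↔ #μ_{(p')}(K̄)^N + 1 = q^{[Γ_K : N]}`** for an open subgroup `N ≤ Γ_K`: by
`natCard_fixedRoots_add_one` the left side counts `q^{[Γ_K : N·I_K]}`, and `N·I_K = N` iff the
(finite) indices agree.  Serre, *Local Fields*, Ch. III §5 Thm. 3 (`E/K` is unramified iff
`f = n`). [cite: SerreLocalFields1979, Ch. III §5 Thm. 3] -/
theorem absInertia_le_iff_natCard {p : ℕ} [Fact p.Prime] (hp : ringChar 𝓀[K] = p)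
    (N : Subgroup (absoluteGaloisGroup K)) (hN : IsOpen (N : Set (absoluteGaloisGroup K))) :
    absInertia K ≤ N ↔ Nat.card {ζ : AlgebraicClosure K | ζ ∈ primeToRootsOfUnity p (AlgebraicClosure K) ∧ ∀ τ ∈ N, τ • ζ = ζ} + 1 = residueFieldCard K ^ N.index := by
  haveI : CompactSpace (absoluteGaloisGroup K) := absoluteGaloisGroup_compactSpace K
  haveI : Finite (absoluteGaloisGroup K ⧸ N) := Subgroup.quotient_finite_of_isOpen N hN
  haveI : N.FiniteIndex := Subgroup.finiteIndex_of_finite_quotient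
  have hq2 : 2 ≤ residueFieldCard K := one_lt_residueFieldCard K
  rw [natCard_fixedRoots_add_one hp N hN]
  constructor
  · intro h
    rw [sup_eq_left.mpr h]
  · intro h
    have hidx : (N ⊔ absInertia K).index = N.index := Nat.pow_right_injective hq2 h
    have hrel := Subgroup.relIndex_mul_index (le_sup_left : N ≤ N ⊔ absInertia K)
    rw [hidx] at hrel
    have h1 : N.relIndex (N ⊔ absInertia K) = 1 :=
      Nat.eq_of_mul_eq_mul_right (Nat.pos_of_ne_zero (Subgroup.FiniteIndex.index_ne_zero (H := N)))
        (by rw [one_mul]; exact hrel)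
    exact le_sup_right.trans (Subgroup.relIndex_eq_one.mp h1)

end Valued

/-! ### The `ℚ_p`-binder statement -/

/-- **`mlf_unramified_criterion` holds**: for an MLF `K/ℚ_p` and a finite subextension `E ⊆ K̄`,
`I_K ≤ Gal(K̄/E)` iff `q_E = q_K^{[E:K]}` (elementary `q = #μ_{(p')} + 1`, `I_K = Gal(K̄/K(μ_{(p')}))`)
— from the valued-model criterion `absInertia_le_iff_natCard` through the bridge (`K` is a
non-archimedean local field of residue characteristic `p`; `inertiaSubgroupMLF = absInertia`;
`residueCardMLF p K = q_K`; `μ_{(p')}(E) = μ_{(p')}(K̄)^{Gal(K̄/E)}`, `[Γ_K : Gal(K̄/E)] = [E:K]` by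
Galois theory). Serre, *Local Fields*, Ch. III §5; Neukirch, *ANT* II (7.12).
[cite: NeukirchANT1999, Ch. II Prop. (7.12)] -/
theorem mlf_unramified_criterion_holds : mlf_unramified_criterion := by
  intro p _ K _ _ _ E _
  classical
  -- the valued structure of `K`
  haveI : IsNonarchimedeanLocalField ℚ_[p] := Padic.isNonarchimedeanLocalField_holds p
  letI := FiniteExtension.normedField ℚ_[p] K
  letI := FiniteExtension.valuativeRel ℚ_[p] K
  haveI : IsNonarchimedeanLocalField K := FiniteExtension.isNonarchimedeanLocalField ℚ_[p] K
  haveI : ValuativeExtension ℚ_[p] K := FiniteExtension.valuativeExtension ℚ_[p] K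
  have hp := ringChar_residueField_eq_of_valuativeExtension (K := K) p
  haveI : CharZero K := charZero_of_injective_algebraMap (algebraMap ℚ_[p] K).injective
  haveI : IsGalois K (AlgebraicClosure K) := inferInstance
  set N := E.fixingSubgroup.comap (absoluteGaloisGroup.toAlgEquiv K).toMonoidHom with hNdef
  have hN : IsOpen (N : Set (absoluteGaloisGroup K)) := E.fixingSubgroup_isOpen
  rw [inertiaSubgroupMLF_eq_absInertia hp, residueCardMLF_eq_residueFieldCard hp,
    absInertia_le_iff_natCard hp N hN]
  -- `[Γ_K : N] = [E : K]`
  have hidx : N.index = Module.finrank K E := by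
    rw [hNdef, Subgroup.index_comap_of_surjective _ (absoluteGaloisGroup.toAlgEquiv K).surjective,
      ← IntermediateField.finrank_eq_fixingSubgroup_index]
  -- `μ_{(p')}(E) ≃ μ_{(p')}(K̄)^N`
  have hmemN : ∀ {τ : absoluteGaloisGroup K}, τ ∈ N ↔ ∀ x : E, τ • (x : AlgebraicClosure K) = x := by
    intro τ
    rw [hNdef, Subgroup.mem_comap]
    change absoluteGaloisGroup.toAlgEquiv K τ ∈ E.fixingSubgroup ↔ _
    rw [IntermediateField.mem_fixingSubgroup_iff]
    exact ⟨fun h x => h x x.2, fun h x hx => h ⟨x, hx⟩⟩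
  have e : primeToRootsOfUnity p E ≃
      {ζ : AlgebraicClosure K | ζ ∈ primeToRootsOfUnity p (AlgebraicClosure K) ∧ ∀ τ ∈ N, τ • ζ = ζ} :=
    { toFun := fun ζ => ⟨(ζ.1 : AlgebraicClosure K), by
        obtain ⟨n, hn, hpn, hζ⟩ := ζ.2
        refine ⟨⟨n, hn, hpn, ?_⟩, fun τ hτ => hmemN.mp hτ ζ.1⟩
        rw [← IntermediateField.coe_pow, hζ]; rfl⟩
      invFun := fun z => ⟨⟨z.1, by
        rw [← InfiniteGalois.fixedField_fixingSubgroup E, IntermediateField.mem_fixedField_iff]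
        intro f hf
        have hf' : (absoluteGaloisGroup.toAlgEquiv K).symm f ∈ N := by
          rw [hNdef, Subgroup.mem_comap]; simpa using hf
        exact z.2.2 _ hf'⟩, by
        obtain ⟨n, hn, hpn, hz⟩ := z.2.1
        refine ⟨n, hn, hpn, ?_⟩
        apply Subtype.ext
        rw [IntermediateField.coe_pow]
        exact hz⟩
      left_inv := fun ζ => Subtype.ext (Subtype.ext rfl)
      right_inv := fun z => Subtype.ext rfl }
  rw [residueCardMLF, Nat.card_congr e, hidx]

end Literature.AnabelianGeometry.AbsoluteAnabelian
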